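import Mathlib
import Summits.AtomisticToContinuum.HydrodynamicLimit.Theorems.InformationPercolationEngineKickFairRelEquilibriumMesoDefs
import Literature.MathematicalPhysics.KineticTheory.HardSphereEulerProofs
import HarnessLib

/-!
# Stub `stub_energyTail` (E2) of the line `Sketch` for the crux `KickFairRelEquilibriumMeso`
(stmt-AtomisticToContinuum-15177)

Large-deviation upper tail of (twice) the kinetic energy `KE = Σᵢ ‖vᵢ‖²` under the invariant
local Gibbs laws `G_θ = localGibbsLaw σ 1 0 θ N Φ` (`0 < σ < 1/2`): for every rate `M ≥ 0` there
is a cap `K` with `G_θ(KE > K (N+1)) ≤ e^{-M (N+1)}` for all `N`.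

Proof (Chernoff): by the disintegration `lintegral_localGibbsMeasure` the velocities are, given the
positions, i.i.d. `gaussMeasure 0 θ` on `ℝ³`; by Fernique's theorem
(`ProbabilityTheory.IsGaussian.exists_integrable_exp_sq`) there is `C > 0` with
`L := ∫ e^{C‖v‖²} d(gaussMeasure 0 θ) < ∞`; Markov's inequality on `e^{C · KE}` and Tonelli on the
product give `⊗ gaussMeasure 0 θ (KE > a) ≤ e^{-C a} L^{N+1}`, and `K := (M + log L) / C` makes
this `e^{-M (N+1)}` at `a = K (N+1)`; the position integral is the normalisation
(`lintegral_posWeight_eq_one`).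
-/

noncomputable section

open MeasureTheory ProbabilityTheory Set Filter Topology
open scoped ENNReal Classical

namespace Summit.AtomisticToContinuum.HydrodynamicLimit.Theorems.KickFairRelEquilibriumMesoLine

open Literature.Analysis.FluidPDE Literature.MathematicalPhysics.KineticTheory

/-- **Chernoff bound for the kinetic energy of i.i.d. isotropic Gaussians.** If `e^{C‖v‖²}` is
integrable for `gaussMeasure 0 θ` (`C > 0`) with integral `L`, then
`(⊗ⁿ gaussMeasure 0 θ) {Σᵢ ‖vᵢ‖² > a} ≤ e^{-C a} Lⁿ`. [folklore] -/
theorem pi_gaussMeasure_energy_tail_le (θ : ℝ) {C : ℝ} (hC : 0 < C)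
    (hint : Integrable (fun v : V3 => Real.exp (C * ‖v‖ ^ 2)) (gaussMeasure (0 : V3) θ))
    (n : ℕ) (a : ℝ) :
    Measure.pi (fun _ : Fin n => gaussMeasure (0 : V3) θ) {v | a < ∑ i, ‖v i‖ ^ 2} ≤
      ENNReal.ofReal (Real.exp (-(C * a)) *
        (∫ v, Real.exp (C * ‖v‖ ^ 2) ∂gaussMeasure (0 : V3) θ) ^ n) := by
  set μ : Measure V3 := gaussMeasure (0 : V3) θ with hμ
  set L : ℝ := ∫ v, Real.exp (C * ‖v‖ ^ 2) ∂μ with hL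
  -- the exponential weight, coordinatewise
  have hgm : Measurable fun w : V3 => ENNReal.ofReal (Real.exp (C * ‖w‖ ^ 2)) :=
    (Real.measurable_exp.comp (measurable_const.mul (measurable_norm.pow_const 2))).ennreal_ofReal
  have hfm : Measurable fun v : Fin n → V3 => ∏ i, ENNReal.ofReal (Real.exp (C * ‖v i‖ ^ 2)) :=
    Finset.measurable_prod _ fun i _ => hgm.comp (measurable_pi_apply i)
  -- the energy event is contained in the level set of the exponential weight
  have hsub : {v : Fin n → V3 | a < ∑ i, ‖v i‖ ^ 2} ⊆
      {v | ENNReal.ofReal (Real.exp (C * a)) ≤ ∏ i, ENNReal.ofReal (Real.exp (C * ‖v i‖ ^ 2))} := by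
    intro v hv
    simp only [mem_setOf_eq] at hv ⊢
    rw [← ENNReal.ofReal_prod_of_nonneg fun i _ => (Real.exp_pos _).le, ← Real.exp_sum,
      ← Finset.mul_sum]
    exact ENNReal.ofReal_le_ofReal (Real.exp_le_exp.2 (mul_le_mul_of_nonneg_left hv.le hC.le))
  -- Markov
  have hmarkov := mul_meas_ge_le_lintegral₀ (μ := Measure.pi fun _ : Fin n => μ)
    hfm.aemeasurable (ENNReal.ofReal (Real.exp (C * a)))
  -- Tonelli on the product
  have hprod : ∫⁻ v, ∏ i, ENNReal.ofReal (Real.exp (C * ‖v i‖ ^ 2)) ∂(Measure.pi fun _ : Fin n => μ) =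
      ENNReal.ofReal L ^ n := by
    rw [lintegral_fin_nat_prod_eq_prod (fun _ : Fin n => μ)
      (f := fun _ w => ENNReal.ofReal (Real.exp (C * ‖w‖ ^ 2))) fun _ => hgm]
    rw [Finset.prod_const, Finset.card_univ, Fintype.card_fin]
    congr 1
    rw [hL, ofReal_integral_eq_lintegral_ofReal hint (ae_of_all _ fun _ => (Real.exp_pos _).le)]
  have hL0 : 0 ≤ L := integral_nonneg fun _ => (Real.exp_pos _).le
  have hone : ENNReal.ofReal (Real.exp (-(C * a))) * ENNReal.ofReal (Real.exp (C * a)) = 1 := by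
    rw [← ENNReal.ofReal_mul (Real.exp_pos _).le, ← Real.exp_add, neg_add_cancel, Real.exp_zero,
      ENNReal.ofReal_one]
  calc Measure.pi (fun _ : Fin n => μ) {v | a < ∑ i, ‖v i‖ ^ 2}
      ≤ Measure.pi (fun _ : Fin n => μ)
          {v | ENNReal.ofReal (Real.exp (C * a)) ≤ ∏ i, ENNReal.ofReal (Real.exp (C * ‖v i‖ ^ 2))} :=
        measure_mono hsub
    _ = ENNReal.ofReal (Real.exp (-(C * a))) * (ENNReal.ofReal (Real.exp (C * a)) *
          Measure.pi (fun _ : Fin n => μ)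
            {v | ENNReal.ofReal (Real.exp (C * a)) ≤
              ∏ i, ENNReal.ofReal (Real.exp (C * ‖v i‖ ^ 2))}) := by
        rw [← mul_assoc, hone, one_mul]
    _ ≤ ENNReal.ofReal (Real.exp (-(C * a))) * ENNReal.ofReal L ^ n := by
        gcongr
        exact hmarkov.trans_eq hprod
    _ = ENNReal.ofReal (Real.exp (-(C * a)) * L ^ n) := by
        rw [ENNReal.ofReal_mul (Real.exp_pos _).le, ENNReal.ofReal_pow hL0]

/-- **E2 — exponential upper tail of the kinetic energy under the invariant local Gibbs laws.**
For `θ > 0` and every rate `M ≥ 0` there is a cap `K` such that for all `N`, all `0 < σ < 1/2`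
and every flow, `G_θ {KE > K (N+1)} ≤ e^{-M (N+1)}` (`G_θ = localGibbsLaw σ 1 0 θ N Φ`; Chernoff
bound for a sum of `N + 1` i.i.d. Gaussian energies). [folklore] -/
theorem stub_energyTail :
    ∀ θ : ℝ, 0 < θ → ∀ M : ℝ, 0 ≤ M → ∃ K : ℝ, ∃ N₀ : ℕ, ∀ N : ℕ, N₀ ≤ N →
      ∀ σ : ℝ, 0 < σ → σ < 1 / 2 → ∀ Φ : Flow σ N,
        localGibbsLaw σ (fun _ => 1) (fun _ => 0) (fun _ => θ) N Φ {z | K * ((N : ℝ) + 1) < kinEnergy z} ≤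
          ENNReal.ofReal (Real.exp (-(M * ((N : ℝ) + 1)))) := by
  intro θ hθ M _hM
  -- Fernique: a uniform exponential moment of `‖v‖²` under `N(0, θ I₃)`
  obtain ⟨C, hC, hint⟩ :=
    ProbabilityTheory.IsGaussian.exists_integrable_exp_sq (gaussMeasure (0 : V3) θ)
  set L : ℝ := ∫ v, Real.exp (C * ‖v‖ ^ 2) ∂gaussMeasure (0 : V3) θ with hL
  have hL1 : 1 ≤ L := by
    have h1 : ∫ _ : V3, (1 : ℝ) ∂gaussMeasure (0 : V3) θ = 1 := by simp
    rw [hL, ← h1]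
    refine integral_mono (integrable_const _) hint fun v => ?_
    exact Real.one_le_exp (mul_nonneg hC.le (sq_nonneg _))
  have hL0 : 0 < L := one_pos.trans_le hL1
  refine ⟨(M + Real.log L) / C, 0, fun N _ σ _hσ hσ2 Φ => ?_⟩
  set K : ℝ := (M + Real.log L) / C with hK
  have hCK : C * K = M + Real.log L := by
    rw [hK]; field_simp
  -- continuity / positivity of the constant profiles
  have ha : Continuous (fun _ : T3 => (1 : ℝ)) := continuous_const
  have hθc : Continuous (fun _ : T3 => θ) := continuous_const
  have hu : Continuous (fun _ : T3 => (0 : V3)) := continuous_const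
  have ha0 : ∀ _x : T3, (0 : ℝ) ≤ 1 := fun _ => zero_le_one
  have ha0' : ∀ _x : T3, (0 : ℝ) < 1 := fun _ => one_pos
  have hθ0 : ∀ _x : T3, 0 < θ := fun _ => hθ
  rw [localGibbsLaw_eq]
  haveI : IsProbabilityMeasure (localGibbsMeasure σ (fun _ => 1) (fun _ => 0) (fun _ => θ) N) :=
    isProbabilityMeasure_localGibbsMeasure ha hθc hu ha0' hθ0 hσ2.le N
  set A : Set (Phase N) := {z | K * ((N : ℝ) + 1) < kinEnergy z} with hA
  have hEm : Measurable fun z : Phase N => kinEnergy z := by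
    unfold kinEnergy
    exact Finset.measurable_sum _ fun i _ => ((measurable_pi_apply i).snd.norm).pow_const 2
  have hAm : MeasurableSet A := measurableSet_lt measurable_const hEm
  -- the conditional (velocity) bound, uniformly in the positions
  have hvel : ∀ x : Fin (N + 1) → T3,
      velMeasure (fun _ => (0 : V3)) (fun _ => θ) x {v | zipConfig (x, v) ∈ A} ≤
        ENNReal.ofReal (Real.exp (-(M * ((N : ℝ) + 1)))) := by
    intro x
    have hset : {v : Fin (N + 1) → V3 | zipConfig (x, v) ∈ A} =
        {v | K * ((N : ℝ) + 1) < ∑ i, ‖v i‖ ^ 2} := by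
      ext v
      simp [hA, kinEnergy]
    have hvm : velMeasure (fun _ => (0 : V3)) (fun _ => θ) x =
        Measure.pi (fun _ : Fin (N + 1) => gaussMeasure (0 : V3) θ) := rfl
    rw [hset, hvm]
    refine (pi_gaussMeasure_energy_tail_le θ hC hint (N + 1) (K * ((N : ℝ) + 1))).trans_eq ?_
    congr 1
    rw [← hL, show C * (K * ((N : ℝ) + 1)) = (M + Real.log L) * ((N : ℝ) + 1) by
      rw [← mul_assoc, hCK]]
    rw [show L ^ (N + 1) = Real.exp (Real.log L * ((N : ℝ) + 1)) by
      rw [← Real.exp_log hL0, Real.log_exp, ← Real.exp_nat_mul]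
      congr 1; push_cast; ring]
    rw [← Real.exp_add]
    congr 1
    ring
  calc localGibbsMeasure σ (fun _ => 1) (fun _ => 0) (fun _ => θ) N A
      = ∫⁻ z, A.indicator 1 z ∂localGibbsMeasure σ (fun _ => 1) (fun _ => 0) (fun _ => θ) N :=
        (lintegral_indicator_one hAm).symm
    _ = ∫⁻ x, ENNReal.ofReal ((canonicalPartition (Torus.geometry (Fin 3)) (hsDiameter σ N)
          (N + 1) (localGibbsProfile (fun _ => 1) (fun _ => 0) (fun _ => θ)))⁻¹ *
            posWeight (fun _ => 1) (hsDiameter σ N) (N + 1) x) *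
          velMeasure (fun _ => (0 : V3)) (fun _ => θ) x {v | zipConfig (x, v) ∈ A} := by
        rw [lintegral_localGibbsMeasure ha hθc hu ha0 hθ0 σ N (measurable_one.indicator hAm)]
        refine lintegral_congr fun x => ?_
        congr 1
        have hpre : MeasurableSet {v : Fin (N + 1) → V3 | zipConfig (x, v) ∈ A} :=
          hAm.preimage (measurable_zipConfig.comp (measurable_const.prodMk measurable_id))
        rw [← lintegral_indicator_one hpre]
        rfl
    _ ≤ ∫⁻ x, ENNReal.ofReal ((canonicalPartition (Torus.geometry (Fin 3)) (hsDiameter σ N)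
          (N + 1) (localGibbsProfile (fun _ => 1) (fun _ => 0) (fun _ => θ)))⁻¹ *
            posWeight (fun _ => 1) (hsDiameter σ N) (N + 1) x) *
          ENNReal.ofReal (Real.exp (-(M * ((N : ℝ) + 1)))) :=
        lintegral_mono fun x => mul_le_mul_right (hvel x) _
    _ = ENNReal.ofReal (Real.exp (-(M * ((N : ℝ) + 1)))) := by
        have hρm : Measurable fun x : Fin (N + 1) → T3 => ENNReal.ofReal
            ((canonicalPartition (Torus.geometry (Fin 3)) (hsDiameter σ N) (N + 1)
              (localGibbsProfile (fun _ => 1) (fun _ => 0) (fun _ => θ)))⁻¹ *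
                posWeight (fun _ => 1) (hsDiameter σ N) (N + 1) x) :=
          (measurable_const.mul (measurable_posWeight ha _ _)).ennreal_ofReal
        rw [lintegral_mul_const _ hρm, lintegral_posWeight_eq_one ha hθc hu ha0 hθ0 σ N, one_mul]

end Summit.AtomisticToContinuum.HydrodynamicLimit.Theorems.KickFairRelEquilibriumMesoLine

end
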